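import Summits.AtomisticToContinuum.Crystallization.Theorems.ChargedEnergyGapSourceKernel
import HarnessLib

/-!
# Charged energy gap — lens-3 g64, node «BarlowRef» (R3) — part 19 (addendum; imports part 18): FULL-SHELL counts, the ISOTROPIC tail, and the per-source kernel of the inner sources

The per-band certificate recipe (HANDOFF g65, item 2) for the sources that are NOT in the tube regime (`a := dist y c ≤ r`, where the tube test
`infDist c [y,z] ≤ r` is vacuous), and the isotropic fallback for any source:

* `orthoCap_neg_eq_closedBall`, `capVol_neg` — a cap of depth `2ρ` is the ball: `orthoCap b y (−ρ) ρ = B̄(y, ρ)`, `capVol ρ (−ρ) = 4πρ³/3`;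
* `volume_shell_le` — `volume (B̄(y,R') ∩ {ρ' ≤ dist · y}) ≤ 4πR'³/3 − 4πρ'³/3` (`0 ≤ ρ' ≤ R'`);
* ★ `card_mul_le_shell_of_subset_image` — `#T · a(a√3/2)h ≤ (4π/3)((R₂ + 9/5)³ − (R₁ − 9/5)³)` for image sites at distance `∈ [R₁, R₂]` from `y`
  (`9/5 ≤ R₁ ≤ R₂`);
* ★ `iso_shell_sum_mul_le` (`(Σ d⁻⁶)·V ≤ (125π/6)/X³` on a dyadic shell `[X, 2X]`, `X ≥ 18/5`) ⇒ ★★ `iso_tail_sum_mul_le`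
  (`(Σ_{dist ≥ U} d⁻⁶)·V ≤ (500π/21)/U³`, `U ≥ 18/5`) — the isotropic tail in closed form;
* ★★ `iso_kernel_mul_le` — for ANY source `y`, cut points `18/5 ≤ β₀ ≤ β₁ ≤ … ≤ β_K`, finite `T ⊆` image with `dist y z ≥ β₀` on `T`:
  `(Σ_{z ∈ T} (dist y z)⁻⁶)·V ≤ Σ_{k<K} (4π/3)((β_{k+1} + 9/5)³ − (β_k − 9/5)³)·β_k⁻⁶ + (500π/21)/β_K³`;
  `inside_kernel_mul_le` — the same for the tube-tested sum (the test is dropped), the form consumed by `tubeLoad`.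

0 sorry; standard axioms.
-/

noncomputable section

open scoped Classical RealInnerProductSpace ENNReal
open MeasureTheory
open Literature.MathematicalPhysics.StatisticalMechanics Literature.Geometry.DiscreteGeometry
open Summit.AtomisticToContinuum.Crystallization.Theses.PricedLinkCensus
open Summit.AtomisticToContinuum.Crystallization.Theorems.ChargedEnergyGapNegative

namespace Summit.AtomisticToContinuum.Crystallization.Theorems.ChargedEnergyGapChartDial

section IsoKernel

/-- A cap of full depth is the closed ball. -/
theorem orthoCap_neg_eq_closedBall (b : OrthonormalBasis (Fin 3) ℝ E3) (y : E3) (ρ : ℝ) :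
    orthoCap b y (-ρ) ρ = Metric.closedBall y ρ := by
  ext x
  simp only [orthoCap, Set.mem_setOf_eq, Metric.mem_closedBall]
  constructor
  · exact fun hx => hx.2
  · intro hx
    refine ⟨?_, hx⟩
    have h1 : |⟪b 2, x - y⟫| ≤ dist x y := by
      calc |⟪b 2, x - y⟫| ≤ ‖b 2‖ * ‖x - y‖ := abs_real_inner_le_norm _ _
        _ = dist x y := by rw [b.orthonormal.1 2, one_mul, dist_eq_norm]
    have h2 := (abs_le.1 h1).1
    linarith

/-- `capVol ρ (−ρ) = 4πρ³/3`. -/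
theorem capVol_neg (ρ : ℝ) : capVol ρ (-ρ) = 4 * Real.pi / 3 * ρ ^ 3 := by
  unfold capVol; ring

/-- The volume of a closed spherical shell: `volume (B̄(y, R') ∩ {ρ' ≤ dist · y}) ≤ 4πR'³/3 − 4πρ'³/3` (`0 ≤ ρ' ≤ R'`). -/
theorem volume_shell_le (y : E3) {ρ' R' : ℝ} (hρ : 0 ≤ ρ') (h3 : ρ' ≤ R') :
    volume (Metric.closedBall y R' ∩ {x | ρ' ≤ dist x y}) ≤
      ENNReal.ofReal (4 * Real.pi / 3 * R' ^ 3) - ENNReal.ofReal (4 * Real.pi / 3 * ρ' ^ 3) := by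
  obtain ⟨b⟩ : Nonempty (OrthonormalBasis (Fin 3) ℝ E3) := ⟨EuclideanSpace.basisFun (Fin 3) ℝ⟩
  set C₂ : Set E3 := Metric.closedBall y ρ' \ Metric.sphere y ρ' with hC₂
  have hC₂sub : C₂ ⊆ Metric.closedBall y R' := by
    rintro x ⟨hx1, -⟩
    exact Metric.closedBall_subset_closedBall h3 hx1
  have hdisj : Disjoint (Metric.closedBall y R' ∩ {x | ρ' ≤ dist x y}) C₂ := by
    rw [Set.disjoint_left]
    rintro x ⟨-, hx⟩ ⟨hx2, hx3⟩
    apply hx3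
    rw [Metric.mem_sphere]
    exact le_antisymm (Metric.mem_closedBall.1 hx2) hx
  have hC₂m : MeasurableSet C₂ := Metric.isClosed_closedBall.measurableSet.diff Metric.isClosed_sphere.measurableSet
  have hC₂vol : volume C₂ = ENNReal.ofReal (4 * Real.pi / 3 * ρ' ^ 3) := by
    rw [hC₂, measure_sdiff_null (Measure.addHaar_sphere volume y ρ'), ← orthoCap_neg_eq_closedBall b y ρ',
      volume_orthoCap_eq b y (le_refl _) (by linarith), capVol_neg]
  have hbig : volume (Metric.closedBall y R') = ENNReal.ofReal (4 * Real.pi / 3 * R' ^ 3) := by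
    rw [← orthoCap_neg_eq_closedBall b y R', volume_orthoCap_eq b y (le_refl _) (by linarith), capVol_neg]
  have hsum : volume (Metric.closedBall y R' ∩ {x | ρ' ≤ dist x y}) + volume C₂ ≤ ENNReal.ofReal (4 * Real.pi / 3 * R' ^ 3) := by
    rw [← measure_union hdisj hC₂m, ← hbig]
    exact measure_mono (Set.union_subset Set.inter_subset_left hC₂sub)
  rw [hC₂vol] at hsum
  exact ENNReal.le_sub_of_add_le_right ENNReal.ofReal_ne_top hsum

/-- ★ THE FULL-SHELL COUNT: window `(a,h)`, `g` isometry, finite `T ⊆ g '' barlowStacking a h s` with `R₁ ≤ dist z y ≤ R₂` on `T`,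
`9/5 ≤ R₁ ≤ R₂` ⟹ `#T · a(a√3/2)h ≤ (4π/3)((R₂ + 9/5)³ − (R₁ − 9/5)³)`. -/
theorem card_mul_le_shell_of_subset_image {a h : ℝ} {s : ℤ → ℤ} {g : E3 → E3}
    (ha : 9 / 10 ≤ a ∧ a ≤ 11 / 10) (hh : 0 < h ∧ 27 / 50 * a ^ 2 ≤ h ^ 2 ∧ h ^ 2 ≤ 121 / 150 * a ^ 2) (hg : Isometry g)
    (y : E3) {R₁ R₂ : ℝ} (hR1 : 9 / 5 ≤ R₁) (hR : R₁ ≤ R₂)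
    (T : Finset E3) (hT : ↑T ⊆ g '' barlowStacking a h s) (hT1 : ∀ z ∈ T, R₁ ≤ dist z y) (hT2 : ∀ z ∈ T, dist z y ≤ R₂) :
    (T.card : ℝ) * (a * (a * √3 / 2) * h) ≤ 4 * Real.pi / 3 * ((R₂ + 9 / 5) ^ 3 - (R₁ - 9 / 5) ^ 3) := by
  have ha0 : 0 ≤ a := by linarith [ha.1]
  have hV0 : 0 ≤ a * (a * √3 / 2) * h := by have := hh.1.le; positivity
  set K : Set E3 := {z | R₁ ≤ dist z y ∧ dist z y ≤ R₂} with hK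
  have hT' : ↑T ⊆ g '' barlowStacking a h s ∩ K := fun z hz =>
    ⟨hT hz, hT1 z (Finset.mem_coe.1 hz), hT2 z (Finset.mem_coe.1 hz)⟩
  have c1 := card_mul_le_volume_near_of_subset_image ha hh hg K T hT'
  have c2 : {x : E3 | ∃ z ∈ K, dist x z ≤ 9 / 5} ⊆ Metric.closedBall y (R₂ + 9 / 5) ∩ {x | R₁ - 9 / 5 ≤ dist x y} := by
    rintro x ⟨z, ⟨hz1, hz2⟩, hxz⟩
    have hd1 := dist_triangle x z y
    have hd2 := dist_triangle z x y
    rw [dist_comm z x] at hd2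
    refine ⟨Metric.mem_closedBall.2 (by linarith), ?_⟩
    show R₁ - 9 / 5 ≤ dist x y
    linarith
  have c3 := (c1.trans (measure_mono c2)).trans (volume_shell_le y (by linarith) (by linarith))
  have hnn2 : 0 ≤ 4 * Real.pi / 3 * (R₁ - 9 / 5) ^ 3 := by
    have : 0 ≤ R₁ - 9 / 5 := by linarith
    positivity
  have hle : 4 * Real.pi / 3 * (R₁ - 9 / 5) ^ 3 ≤ 4 * Real.pi / 3 * (R₂ + 9 / 5) ^ 3 := by
    have h0 : 0 ≤ R₁ - 9 / 5 := by linarith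
    have h1 : (R₁ - 9 / 5) ^ 3 ≤ (R₂ + 9 / 5) ^ 3 := pow_le_pow_left₀ h0 (by linarith) 3
    exact mul_le_mul_of_nonneg_left h1 (by positivity)
  rw [← ENNReal.ofReal_sub _ hnn2, ← ENNReal.ofReal_natCast, ← ENNReal.ofReal_mul (Nat.cast_nonneg _),
    ENNReal.ofReal_le_ofReal_iff (sub_nonneg.2 hle)] at c3
  linarith [c3]

/-- ★ ONE DYADIC SHELL, isotropic: members of `T ⊆` image with `X ≤ dist y z ≤ 2X` (`X ≥ 18/5`) ⟹ `(Σ (dist y z)⁻¹^6) · V ≤ (125π/6)/X³`. -/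
theorem iso_shell_sum_mul_le {a h : ℝ} {s : ℤ → ℤ} {g : E3 → E3}
    (ha : 9 / 10 ≤ a ∧ a ≤ 11 / 10) (hh : 0 < h ∧ 27 / 50 * a ^ 2 ≤ h ^ 2 ∧ h ^ 2 ≤ 121 / 150 * a ^ 2) (hg : Isometry g)
    (y : E3) {X : ℝ} (hX : 18 / 5 ≤ X) (T : Finset E3) (hT : ↑T ⊆ g '' barlowStacking a h s)
    (hsh : ∀ z ∈ T, X ≤ dist y z ∧ dist y z ≤ 2 * X) :
    (∑ z ∈ T, (dist y z)⁻¹ ^ 6) * (a * (a * √3 / 2) * h) ≤ 125 * Real.pi / 6 / X ^ 3 := by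
  have hX0 : 0 < X := by linarith
  have ha0 : 0 ≤ a := by linarith [ha.1]
  have hV0 : 0 ≤ a * (a * √3 / 2) * h := by have := hh.1.le; positivity
  have hcount := card_mul_le_shell_of_subset_image (R₁ := X) (R₂ := 2 * X) ha hh hg y (by linarith) (by linarith) T hT
    (fun z hz => by rw [dist_comm]; exact (hsh z hz).1) (fun z hz => by rw [dist_comm]; exact (hsh z hz).2)
  have hw : ∀ z ∈ T, (dist y z)⁻¹ ^ 6 ≤ X⁻¹ ^ 6 := fun z hz =>
    pow_le_pow_left₀ (inv_nonneg.2 dist_nonneg) (inv_anti₀ hX0 (hsh z hz).1) 6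
  have hsum : ∑ z ∈ T, (dist y z)⁻¹ ^ 6 ≤ T.card * X⁻¹ ^ 6 := by
    calc ∑ z ∈ T, (dist y z)⁻¹ ^ 6 ≤ ∑ z ∈ T, X⁻¹ ^ 6 := Finset.sum_le_sum hw
      _ = T.card * X⁻¹ ^ 6 := by rw [Finset.sum_const, nsmul_eq_mul]
  have hvol : 4 * Real.pi / 3 * ((2 * X + 9 / 5) ^ 3 - (X - 9 / 5) ^ 3) ≤ 125 * Real.pi / 6 * X ^ 3 := by
    have h1 : (2 * X + 9 / 5) ^ 3 ≤ (5 / 2 * X) ^ 3 := pow_le_pow_left₀ (by linarith) (by linarith) 3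
    have h2 : 0 ≤ (X - 9 / 5) ^ 3 := pow_nonneg (by linarith) 3
    have hπ := Real.pi_pos.le
    nlinarith [mul_le_mul_of_nonneg_left h1 hπ, mul_nonneg hπ h2]
  have hX6 : 0 ≤ X⁻¹ ^ 6 := by positivity
  calc (∑ z ∈ T, (dist y z)⁻¹ ^ 6) * (a * (a * √3 / 2) * h)
      ≤ T.card * X⁻¹ ^ 6 * (a * (a * √3 / 2) * h) := mul_le_mul_of_nonneg_right hsum hV0
    _ = (T.card : ℝ) * (a * (a * √3 / 2) * h) * X⁻¹ ^ 6 := by ring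
    _ ≤ 4 * Real.pi / 3 * ((2 * X + 9 / 5) ^ 3 - (X - 9 / 5) ^ 3) * X⁻¹ ^ 6 := mul_le_mul_of_nonneg_right hcount hX6
    _ ≤ 125 * Real.pi / 6 * X ^ 3 * X⁻¹ ^ 6 := mul_le_mul_of_nonneg_right hvol hX6
    _ = 125 * Real.pi / 6 / X ^ 3 := by field_simp

/-- A finite geometric sum with ratio `0 ≤ x < 1` is at most `1/(1 − x)` (private: public twins exist in unrelated namespaces). -/
private theorem geom_sum_range_le_one_div' {x : ℝ} (hx : 0 ≤ x) (hx1 : x < 1) (N : ℕ) : ∑ i ∈ Finset.range N, x ^ i ≤ 1 / (1 - x) := by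
  have h := geom_sum_Ico_le_of_lt_one (m := 0) (n := N) hx hx1
  rwa [pow_zero, ← Finset.range_eq_Ico] at h

/-- ★★ THE ISOTROPIC TAIL: members of `T ⊆` image with `dist y z ≥ U ≥ 18/5` ⟹ `(Σ (dist y z)⁻¹^6) · V ≤ (500π/21)/U³`
(dyadic shells `[U2ⁿ, U2ⁿ⁺¹]`, `Σ 8⁻ⁿ ≤ 8/7`). -/
theorem iso_tail_sum_mul_le {a h : ℝ} {s : ℤ → ℤ} {g : E3 → E3}
    (ha : 9 / 10 ≤ a ∧ a ≤ 11 / 10) (hh : 0 < h ∧ 27 / 50 * a ^ 2 ≤ h ^ 2 ∧ h ^ 2 ≤ 121 / 150 * a ^ 2) (hg : Isometry g)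
    (y : E3) {U : ℝ} (hU : 18 / 5 ≤ U) (T : Finset E3) (hT : ↑T ⊆ g '' barlowStacking a h s) (hfar : ∀ z ∈ T, U ≤ dist y z) :
    (∑ z ∈ T, (dist y z)⁻¹ ^ 6) * (a * (a * √3 / 2) * h) ≤ 500 * Real.pi / 21 / U ^ 3 := by
  have hU0 : 0 < U := by linarith
  have hex : ∀ z ∈ T, ∃ n : ℕ, U * 2 ^ n ≤ dist y z ∧ dist y z ≤ U * 2 ^ (n + 1) := by
    intro z hz
    have h1 : 1 ≤ dist y z / U := by rw [le_div_iff₀ hU0, one_mul]; exact hfar z hz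
    obtain ⟨n, hn1, hn2⟩ := exists_nat_pow_near h1 one_lt_two
    refine ⟨n, ?_, ?_⟩
    · have := (le_div_iff₀ hU0).1 hn1; linarith [this]
    · have := (div_lt_iff₀ hU0).1 hn2; linarith [this]
  let nOf : E3 → ℕ := fun z => if hz : z ∈ T then (hex z hz).choose else 0
  have hnOf : ∀ z ∈ T, U * 2 ^ nOf z ≤ dist y z ∧ dist y z ≤ U * 2 ^ (nOf z + 1) := by
    intro z hz
    have e : nOf z = (hex z hz).choose := dif_pos hz
    rw [e]
    exact (hex z hz).choose_spec
  set S : Finset ℕ := T.image nOf with hS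
  obtain ⟨N, hN⟩ := Finset.exists_nat_subset_range S
  have hfib : ∑ z ∈ T, (dist y z)⁻¹ ^ 6 = ∑ n ∈ S, ∑ z ∈ T with nOf z = n, (dist y z)⁻¹ ^ 6 :=
    (Finset.sum_fiberwise_of_maps_to (fun z hz => Finset.mem_image_of_mem nOf hz) _).symm
  have hshell : ∀ n ∈ S, (∑ z ∈ T with nOf z = n, (dist y z)⁻¹ ^ 6) * (a * (a * √3 / 2) * h) ≤ 125 * Real.pi / 6 / (U * 2 ^ n) ^ 3 := by
    intro n hn
    have hXn : 18 / 5 ≤ U * 2 ^ n := hU.trans (le_mul_of_one_le_right hU0.le (one_le_pow₀ one_le_two))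
    refine iso_shell_sum_mul_le ha hh hg y hXn _ (subset_trans (Finset.coe_subset.2 (Finset.filter_subset _ _)) hT) ?_
    intro z hz
    rw [Finset.mem_filter] at hz
    obtain ⟨hzT, hzn⟩ := hz
    obtain ⟨h1, h2⟩ := hnOf z hzT
    rw [hzn] at h1 h2
    exact ⟨h1, by calc dist y z ≤ U * 2 ^ (n + 1) := h2
      _ = 2 * (U * 2 ^ n) := by ring⟩
  have h8 : ∀ n : ℕ, 125 * Real.pi / 6 / (U * 2 ^ n) ^ 3 = 125 * Real.pi / 6 / U ^ 3 * (1 / 8) ^ n := by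
    intro n
    have e : (1 / 8 : ℝ) ^ n = 1 / (2 ^ n) ^ 3 := by
      rw [div_pow, one_pow, show (8 : ℝ) = 2 ^ 3 by norm_num, ← pow_mul, mul_comm 3 n, pow_mul]
    rw [e, mul_pow]
    field_simp
  have hA0 : 0 ≤ 125 * Real.pi / 6 / U ^ 3 := by positivity
  have hg8 := geom_sum_range_le_one_div' (x := (1 / 8 : ℝ)) (by norm_num) (by norm_num) N
  calc (∑ z ∈ T, (dist y z)⁻¹ ^ 6) * (a * (a * √3 / 2) * h)
      = ∑ n ∈ S, (∑ z ∈ T with nOf z = n, (dist y z)⁻¹ ^ 6) * (a * (a * √3 / 2) * h) := by rw [hfib, Finset.sum_mul]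
    _ ≤ ∑ n ∈ S, 125 * Real.pi / 6 / U ^ 3 * (1 / 8 : ℝ) ^ n := Finset.sum_le_sum fun n hn => by rw [← h8]; exact hshell n hn
    _ ≤ ∑ n ∈ Finset.range N, 125 * Real.pi / 6 / U ^ 3 * (1 / 8 : ℝ) ^ n :=
          Finset.sum_le_sum_of_subset_of_nonneg hN fun n _ _ => by positivity
    _ = 125 * Real.pi / 6 / U ^ 3 * ∑ n ∈ Finset.range N, (1 / 8 : ℝ) ^ n := by rw [Finset.mul_sum]
    _ ≤ 125 * Real.pi / 6 / U ^ 3 * (1 / (1 - 1 / 8)) := mul_le_mul_of_nonneg_left hg8 hA0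
    _ = 500 * Real.pi / 21 / U ^ 3 := by ring

/-- ★★ The ISOTROPIC per-source kernel: ANY source `y`, cut points `18/5 ≤ β₀ ≤ β₁ ≤ … ≤ β_K`, finite `T ⊆` image with
`dist y z ≥ β₀` on `T` ⟹ `(Σ_{z ∈ T} (dist y z)⁻⁶)·V ≤ Σ_{k<K} (4π/3)((β_{k+1} + 9/5)³ − (β_k − 9/5)³)·β_k⁻⁶ + (500π/21)/β_K³`. -/
theorem iso_kernel_mul_le {a h : ℝ} {s : ℤ → ℤ} {g : E3 → E3}
    (ha : 9 / 10 ≤ a ∧ a ≤ 11 / 10) (hh : 0 < h ∧ 27 / 50 * a ^ 2 ≤ h ^ 2 ∧ h ^ 2 ≤ 121 / 150 * a ^ 2) (hg : Isometry g)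
    (y : E3) (β : ℕ → ℝ) (K : ℕ) (hmono : ∀ k, β k ≤ β (k + 1)) (hβ0 : 18 / 5 ≤ β 0)
    (T : Finset E3) (hT : ↑T ⊆ g '' barlowStacking a h s) (hTy : ∀ z ∈ T, β 0 ≤ dist y z) :
    (∑ z ∈ T, (dist y z)⁻¹ ^ 6) * (a * (a * √3 / 2) * h) ≤
      ∑ k ∈ Finset.range K, 4 * Real.pi / 3 * ((β (k + 1) + 9 / 5) ^ 3 - (β k - 9 / 5) ^ 3) * (β k)⁻¹ ^ 6 +
        500 * Real.pi / 21 / β K ^ 3 := by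
  have ha0 : 0 ≤ a := by linarith [ha.1]
  have hV0 : 0 ≤ a * (a * √3 / 2) * h := by have := hh.1.le; positivity
  have hβpos : ∀ k, 18 / 5 ≤ β k := fun k => hβ0.trans (le_of_succ_le_nat hmono k)
  -- class index by distance
  set cls : E3 → ℕ := fun z => Nat.findGreatest (fun k => β k ≤ dist y z) K with hcls
  have hcls_le : ∀ z, cls z ≤ K := fun z => Nat.findGreatest_le K
  have hcls_spec : ∀ z ∈ T, β (cls z) ≤ dist y z := fun z hz =>
    Nat.findGreatest_spec (P := fun k => β k ≤ dist y z) (Nat.zero_le K) (hTy z hz)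
  have hcls_lt : ∀ z ∈ T, cls z < K → dist y z < β (cls z + 1) := fun z _ hlt =>
    lt_of_not_ge (Nat.findGreatest_is_greatest (P := fun k => β k ≤ dist y z) (Nat.lt_succ_self _) hlt)
  have hfib : ∑ z ∈ T, (dist y z)⁻¹ ^ 6 = ∑ k ∈ Finset.range (K + 1), ∑ z ∈ T with cls z = k, (dist y z)⁻¹ ^ 6 := by
    rw [Finset.sum_fiberwise_of_maps_to]
    intro z _
    exact Finset.mem_range.2 (Nat.lt_succ_of_le (hcls_le z))
  have hclass : ∀ k ∈ Finset.range K, (∑ z ∈ T with cls z = k, (dist y z)⁻¹ ^ 6) * (a * (a * √3 / 2) * h) ≤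
      4 * Real.pi / 3 * ((β (k + 1) + 9 / 5) ^ 3 - (β k - 9 / 5) ^ 3) * (β k)⁻¹ ^ 6 := by
    intro k hk
    have hkK : k < K := Finset.mem_range.1 hk
    have hβk : 0 < β k := by linarith [hβpos k]
    set Tk := T.filter (fun z => cls z = k) with hTk
    have hmem : ∀ z ∈ Tk, z ∈ T ∧ β k ≤ dist y z ∧ dist y z < β (k + 1) := by
      intro z hz
      rw [hTk, Finset.mem_filter] at hz
      obtain ⟨hzT, hzk⟩ := hz
      have hsp := hcls_spec z hzT
      have hlt := hcls_lt z hzT (hzk ▸ hkK)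
      rw [hzk] at hsp hlt
      exact ⟨hzT, hsp, hlt⟩
    have hw : ∀ z ∈ Tk, (dist y z)⁻¹ ^ 6 ≤ (β k)⁻¹ ^ 6 := fun z hz =>
      pow_le_pow_left₀ (inv_nonneg.2 dist_nonneg) (inv_anti₀ hβk (hmem z hz).2.1) 6
    have h1 : ∑ z ∈ Tk, (dist y z)⁻¹ ^ 6 ≤ Tk.card * (β k)⁻¹ ^ 6 := by
      rw [← nsmul_eq_mul, ← Finset.sum_const]
      exact Finset.sum_le_sum hw
    have h2 := card_mul_le_shell_of_subset_image ha hh hg y (by linarith [hβpos k]) (hmono k) Tk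
      (subset_trans (Finset.coe_subset.2 (Finset.filter_subset _ _)) hT)
      (fun z hz => by rw [dist_comm]; exact (hmem z hz).2.1) (fun z hz => by rw [dist_comm]; exact (hmem z hz).2.2.le)
    calc (∑ z ∈ Tk, (dist y z)⁻¹ ^ 6) * (a * (a * √3 / 2) * h)
        ≤ (Tk.card * (β k)⁻¹ ^ 6) * (a * (a * √3 / 2) * h) := mul_le_mul_of_nonneg_right h1 hV0
      _ = (Tk.card * (a * (a * √3 / 2) * h)) * (β k)⁻¹ ^ 6 := by ring
      _ ≤ 4 * Real.pi / 3 * ((β (k + 1) + 9 / 5) ^ 3 - (β k - 9 / 5) ^ 3) * (β k)⁻¹ ^ 6 :=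
          mul_le_mul_of_nonneg_right h2 (by positivity)
  have htail : (∑ z ∈ T with cls z = K, (dist y z)⁻¹ ^ 6) * (a * (a * √3 / 2) * h) ≤ 500 * Real.pi / 21 / β K ^ 3 := by
    refine iso_tail_sum_mul_le (s := s) ha hh hg y (hβpos K) _ ?_ ?_
    · exact subset_trans (Finset.coe_subset.2 (Finset.filter_subset _ _)) hT
    · intro z hz
      obtain ⟨hzT, hzk⟩ := Finset.mem_filter.1 hz
      have hsp := hcls_spec z hzT
      rw [hzk] at hsp
      exact hsp
  rw [hfib, Finset.sum_range_succ, add_mul, Finset.sum_mul]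
  exact add_le_add (Finset.sum_le_sum hclass) htail

/-- The form consumed by `tubeLoad`: the distance start `β₀ ≤ dist y z` is only required of the targets SEEN THROUGH THE TUBE (for the inner
sources `dist y c ≤ r` the test is vacuous; for the others part 18's `add_le_dist_of_test` supplies a start beyond the pair separation). -/
theorem inside_kernel_mul_le {a h : ℝ} {s : ℤ → ℤ} {g : E3 → E3}
    (ha : 9 / 10 ≤ a ∧ a ≤ 11 / 10) (hh : 0 < h ∧ 27 / 50 * a ^ 2 ≤ h ^ 2 ∧ h ^ 2 ≤ 121 / 150 * a ^ 2) (hg : Isometry g)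
    (y c : E3) (r : ℝ) (β : ℕ → ℝ) (K : ℕ) (hmono : ∀ k, β k ≤ β (k + 1)) (hβ0 : 18 / 5 ≤ β 0)
    (T : Finset E3) (hT : ↑T ⊆ g '' barlowStacking a h s)
    (hTy : ∀ z ∈ T, y ≠ z → Metric.infDist c (segment ℝ y z) ≤ r → β 0 ≤ dist y z) :
    (∑ z ∈ T, if y ≠ z ∧ Metric.infDist c (segment ℝ y z) ≤ r then (dist y z)⁻¹ ^ 6 else 0) * (a * (a * √3 / 2) * h) ≤
      ∑ k ∈ Finset.range K, 4 * Real.pi / 3 * ((β (k + 1) + 9 / 5) ^ 3 - (β k - 9 / 5) ^ 3) * (β k)⁻¹ ^ 6 +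
        500 * Real.pi / 21 / β K ^ 3 := by
  rw [← Finset.sum_filter]
  refine iso_kernel_mul_le ha hh hg y β K hmono hβ0 _ (subset_trans (Finset.coe_subset.2 (Finset.filter_subset _ T)) hT) ?_
  intro z hz
  rw [Finset.mem_filter] at hz
  exact hTy z hz.1 hz.2.1 hz.2.2

end IsoKernel

end Summit.AtomisticToContinuum.Crystallization.Theorems.ChargedEnergyGapChartDial

end
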